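import Summits.RiemannHypothesis.RiemannHypothesis.Theses.SpectralTrace
import Summits.RiemannHypothesis.RiemannHypothesis.Theorems.WindowStep.Negative.Collapse
import Summits.RiemannHypothesis.RiemannHypothesis.Theorems.SpectralTraceWindowStepFirstRungRegular
import Summits.RiemannHypothesis.RiemannHypothesis.Theorems.SpectralTraceWindowStepFirstOctave
import Summits.RiemannHypothesis.RiemannHypothesis.Theorems.SpectralTraceWindowStepConjugateSplit
import Summits.RiemannHypothesis.RiemannHypothesis.Theorems.SpectralTraceWindowTraceArchStubCompactness
import Summits.RiemannHypothesis.RiemannHypothesis.Theorems.SpectralTraceWindowTraceArchStubDomination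
import Summits.RiemannHypothesis.RiemannHypothesis.Theorems.SpectralTraceWindowTraceArchDesignIff
import HarnessLib

/-!
# Line `first-octave-ladder` — birth skeleton for the split child `CrystRegular`
# (child 1 of the route split `WindowStep ⟸ CrystRegular ∧ NoDegenerateEdge`, route SpectralTrace)

Crux (route decl after the split, FIXED):
`Summit.RiemannHypothesis.RiemannHypothesis.Theses.SpectralTrace.CrystRegular`
`= ∀ B ≥ log 2, WindowTraceArch → 0 < ε(B/2) → Trace(B)` — the INTERIOR horn of the conjugate-point
dichotomy: from the archimedean seed, every window level whose half level is REGULAR for Weil's form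
(`ε = weilGroundEnergy`, spectral slack `0 < ε(B/2)`) carries a real unit-multiplicity trace family.
(`Trace(A)`: some real family `γ` reproduces `W = weilFunctional`, `HasSum`, on the Weil tests
supported in `[-A, A]`.)

THE CUT (three registered stubs, two layers of content):

1. `stub_firstOctave` — `WindowTraceArch → WindowTracePrime2`: the first ARITHMETIC octave
   `B ∈ [log 2, log 3]` of the child is EXACTLY the existing sibling crux item `WindowTracePrime2`
   (stmt-RiemannHypothesis-11196) from the seed (`crystRegular_first_octave_iff`, p143818; the half level
   `(log 3)/2` is regular: `weilGroundEnergy_log_three_half_pos`, p141362). It has its own live lead and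
   three checked lines (`Cruxes/WindowTracePrime2/Lines/`), so this stub is attacked THERE, never here.
2. `stub_designReduction` (RH-FREE, M) — the level-`B` form of the landed design machinery of the seed's
   line `defect-compactness-design`: for `B ≥ log 2`, if some log-sparse configuration `x` admits, with ONE
   displacement budget `D`, a bounded real displacement exact on every FINITE list of Weil tests of
   `[-B, B]`, then `Trace(B)`. Proof plan: `stub_compactness` and `stub_domination` are LANDED and
   level-free (Theorems/SpectralTraceWindowTraceArchStubCompactness|Domination); the dense countable test
   family and the dense-to-all extension are landed at level `log 2` (StubDenseFamily, StubExtensionOfDense)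
   and generalise verbatim to level `B` (the Weil side of a test of `[-B, B]` is polar + archimedean + the
   FINITE prime sum over `m < e^B`, continuous in the `C²` sup-norms).
3. `stub_regularDesigns` (OPEN, RH-implied, the bet) — for `B > log 3`, from the first arithmetic rung
   `WindowTracePrime2` and the slack `0 < ε(B/2)`: bounded-displacement designs exact on every finite test
   list of `[-B, B]` exist with one budget. TRANSFER: given stubs 1–2 this is the child on `B > log 3`
   (designs ⟸ trace is the landed structure theorem `designStatement_of_windowTraceArch`'s argument:
   counting law + sorted enumeration + displacement bound, all landed and level-free for `B ≥ log 2`);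
   WHY EASIER: the unknown is a point of the compact cube `[-D, D]^ℕ`, exactness on a FINITE list with
   SLACK is an open condition met list by list (interior of the finite moment cone; Brouwer acute-angle form
   `stub_acuteAngle`, landed), and the whole difficulty is ONE number — a budget `D(B)` uniform in the list.
   In the threshold model of `WindowTraceArch ∧ ¬RH` it fails iff the integer ladder dies with slack above
   `log 3` (`log 3 ≤ A‡ < 2a⋆`).

Composition `CrystRegular_of` (pure logic, no `sorry`): `B ≤ log 3` — stub 1 and antitonicity
(`windowTrace_anti`); `B > log 3` — stub 3 fed by stub 1, then stub 2.

Disproof.lean (parent crux, v2) honoured: (H1)/(H2) of LoadBearing concern the parent's binders; here the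
seed `WindowTraceArch` is consumed by stub 1 and the slack by stub 3; no stub edits a given family
(Nested / FiniteMoves / BothWays / BelowHeight not engaged); no stub is an instance of a landed Negative lemma
(UnitMass / LocalWeyl constrain witnesses, which stub 2's output satisfies by construction: poly-profile
configuration + bounded displacement ⇒ local counts `≍ log T`).
-/

set_option linter.dupNamespace false

noncomputable section

open Complex Set Filter
open scoped Topology

namespace Summit.RiemannHypothesis.RiemannHypothesis.Cruxes.CrystRegular.FirstOctaveLadder

open Literature.NumberTheory.LFunctions
open Summit.RiemannHypothesis.RiemannHypothesis.Theses.SpectralTrace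
open Summit.RiemannHypothesis.RiemannHypothesis.Theorems
open Summit.RiemannHypothesis.RiemannHypothesis.Theorems.WindowStep.Negative

/-- File-local spelling of `Trace(A)` (verbatim the shape of the route decls). -/
local notation3 "WTrace " A:max => ∃ (ι : Type) (γ : ι → ℝ), ∀ g : ℝ → ℂ, IsWeilTest g →
  tsupport g ⊆ Set.Icc (-A) A →
    HasSum (fun i => weilMellin g (1 / 2 + (γ i : ℂ) * I)) (weilFunctional g)

/-! ## Vocabulary (definitions only) -/

/-- Polynomial local count profile of a configuration `x : ℕ → ℝ` (verbatim the seed line's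
`PolyProfile`): at most `C (1+|T|)^N` indices land in `[T-1, T+1]`. -/
def PolyProfile (x : ℕ → ℝ) (C : ℝ) (N : ℕ) : Prop :=
  ∀ (T : ℝ) (s : Finset ℕ), (∀ n ∈ s, |x n - T| ≤ 1) → (s.card : ℝ) ≤ C * (1 + |T|) ^ N

/-- **Designs at level `B`**: some log-sparse configuration `x` and ONE budget `D` such that every finite
list of Weil tests of `[-B, B]` is reproduced exactly by a real displacement of `x` of size `≤ D`. -/
def DesignsAt (B : ℝ) : Prop :=
  ∃ (x : ℕ → ℝ) (C : ℝ) (N : ℕ), PolyProfile x C N ∧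
    ∃ D : ℝ, ∀ (g : ℕ → ℝ → ℂ) (m : ℕ),
      (∀ j, IsWeilTest (g j) ∧ tsupport (g j) ⊆ Icc (-B) B) →
      ∃ δ : ℕ → ℝ, (∀ n, |δ n| ≤ D) ∧
        ∀ j < m, HasSum (fun n => weilMellin (g j) (1 / 2 + ((x n + δ n : ℝ) : ℂ) * I))
          (weilFunctional (g j))

/-- The child, spelled out (verbatim the route decl `SpectralTrace.CrystRegular`). -/
def CrystRegularStatement : Prop :=
  ∀ B : ℝ, Real.log 2 ≤ B → WindowTraceArch → 0 < weilGroundEnergy (B / 2) → WTrace B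

/-! ## THE REGISTERED STUBS (`sorry` lives only here) -/

/-- **stub_firstOctave (= sibling crux `WindowTracePrime2`, stmt-RiemannHypothesis-11196, from the seed;
XL; live lead + 3 checked lines under `Cruxes/WindowTracePrime2/Lines/`).** The first arithmetic rung
`Trace(log 3)` from the archimedean seed `Trace(log 2)`: the prime power `2` enters as the spike pair
`−(log 2/√2)(δ_{log 2} + δ_{−log 2})`. Kernel-identified with the child's first octave
(`crystRegular_first_octave_iff`). -/
theorem stub_firstOctave :
    Summit.RiemannHypothesis.RiemannHypothesis.Theses.SpectralTrace.WindowTraceArch →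
      Summit.RiemannHypothesis.RiemannHypothesis.Theses.SpectralTrace.WindowTracePrime2 := by
  sorry

/-- **stub_designReduction (RH-FREE, M) — designs at level `B ≥ log 2` give the rung `Trace(B)`.**
From a log-sparse configuration `x`, a budget `D` and, for every finite list of tests of `[-B, B]`, an
exact displacement within the budget: enumerate a countable `C^k`-dense family of tests of `[-B, B]`
(level-`B` copy of the landed `stub_denseFamily`), pass to a pointwise limit displacement exact on the
whole dense family (`stub_compactness`, LANDED, level-free, fed by `stub_domination`, LANDED), and extend
to every test of `[-B, B]` by continuity of both sides (level-`B` copy of `stub_extensionOfDense`: the Weil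
side carries the finite prime sum over `m < e^B`, a finite sum of point evaluations). -/
theorem stub_designReduction :
    ∀ B : ℝ, Real.log 2 ≤ B →
      (∃ (x : ℕ → ℝ) (C : ℝ) (N : ℕ),
        (∀ (T : ℝ) (s : Finset ℕ), (∀ n ∈ s, |x n - T| ≤ 1) → (s.card : ℝ) ≤ C * (1 + |T|) ^ N) ∧
        ∃ D : ℝ, ∀ (g : ℕ → ℝ → ℂ) (m : ℕ),
          (∀ j, Literature.NumberTheory.LFunctions.IsWeilTest (g j) ∧ tsupport (g j) ⊆ Set.Icc (-B) B) →
          ∃ δ : ℕ → ℝ, (∀ n, |δ n| ≤ D) ∧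
            ∀ j < m, HasSum
              (fun n => Literature.NumberTheory.LFunctions.weilMellin (g j) (1 / 2 + ((x n + δ n : ℝ) : ℂ) * Complex.I))
              (Literature.NumberTheory.LFunctions.weilFunctional (g j))) →
      ∃ (ι : Type) (γ : ι → ℝ), ∀ g : ℝ → ℂ, Literature.NumberTheory.LFunctions.IsWeilTest g →
        tsupport g ⊆ Set.Icc (-B) B →
          HasSum (fun i => Literature.NumberTheory.LFunctions.weilMellin g (1 / 2 + (γ i : ℂ) * Complex.I))
            (Literature.NumberTheory.LFunctions.weilFunctional g) := by
  sorry

/-- **stub_regularDesigns (OPEN, RH-implied; HARDEST — the regular ladder above the first arithmetic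
rung, in design form).** For `B > log 3`, from the rung `Trace(log 3)` and the spectral slack
`0 < ε(B/2)`: some log-sparse configuration admits, with one budget, bounded real displacements exact on
every finite list of Weil tests of `[-B, B]`. List by list this is an open condition inside the finite
moment cone (the slack keeps the target in its interior); the content is the UNIFORM budget. Fails, in the
threshold model of `WindowTraceArch ∧ ¬RH`, iff the integer ladder dies with slack above `log 3`. -/
theorem stub_regularDesigns :
    ∀ B : ℝ, Real.log 3 < B →
      Summit.RiemannHypothesis.RiemannHypothesis.Theses.SpectralTrace.WindowTracePrime2 →
        0 < Literature.NumberTheory.LFunctions.weilGroundEnergy (B / 2) →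
          ∃ (x : ℕ → ℝ) (C : ℝ) (N : ℕ),
            (∀ (T : ℝ) (s : Finset ℕ), (∀ n ∈ s, |x n - T| ≤ 1) → (s.card : ℝ) ≤ C * (1 + |T|) ^ N) ∧
            ∃ D : ℝ, ∀ (g : ℕ → ℝ → ℂ) (m : ℕ),
              (∀ j, Literature.NumberTheory.LFunctions.IsWeilTest (g j) ∧ tsupport (g j) ⊆ Set.Icc (-B) B) →
              ∃ δ : ℕ → ℝ, (∀ n, |δ n| ≤ D) ∧
                ∀ j < m, HasSum
                  (fun n => Literature.NumberTheory.LFunctions.weilMellin (g j) (1 / 2 + ((x n + δ n : ℝ) : ℂ) * Complex.I))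
                  (Literature.NumberTheory.LFunctions.weilFunctional (g j)) := by
  sorry

/-! ## Consistency: each named statement IS its registered stub -/

theorem designsAt_iff (B : ℝ) : DesignsAt B ↔
    ∃ (x : ℕ → ℝ) (C : ℝ) (N : ℕ),
      (∀ (T : ℝ) (s : Finset ℕ), (∀ n ∈ s, |x n - T| ≤ 1) → (s.card : ℝ) ≤ C * (1 + |T|) ^ N) ∧
      ∃ D : ℝ, ∀ (g : ℕ → ℝ → ℂ) (m : ℕ),
        (∀ j, IsWeilTest (g j) ∧ tsupport (g j) ⊆ Set.Icc (-B) B) →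
        ∃ δ : ℕ → ℝ, (∀ n, |δ n| ≤ D) ∧
          ∀ j < m, HasSum (fun n => weilMellin (g j) (1 / 2 + ((x n + δ n : ℝ) : ℂ) * I))
            (weilFunctional (g j)) := Iff.rfl

/-! ## Name-keyed aliases (the hypotheses of the composition) -/
namespace Registered

/-- Alias keyed by the registered stub name. -/
abbrev stub_firstOctave : Prop := WindowTraceArch → WindowTracePrime2
/-- Alias keyed by the registered stub name. -/
abbrev stub_designReduction : Prop := ∀ B : ℝ, Real.log 2 ≤ B → DesignsAt B → WTrace B
/-- Alias keyed by the registered stub name. -/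
abbrev stub_regularDesigns : Prop :=
  ∀ B : ℝ, Real.log 3 < B → WindowTracePrime2 → 0 < weilGroundEnergy (B / 2) → DesignsAt B

end Registered

/-! ## Kernel-checked glue (no `sorry` below this line) -/

/-- **THE LINE CONCLUDES THE CHILD** (pure logic over the three registered stubs): on the first octave
`B ≤ log 3` the sibling rung serves by antitonicity; above `log 3`, designs with slack (stub 3, fed the
rung of stub 1) and the RH-free reduction (stub 2). -/
theorem crystRegular_of (h₁ : Registered.stub_firstOctave) (h₂ : Registered.stub_designReduction)
    (h₃ : Registered.stub_regularDesigns) : CrystRegularStatement := by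
  intro B hB2 hArch hε
  by_cases hB3 : B ≤ Real.log 3
  · exact windowTrace_anti hB3 (h₁ hArch)
  · have hlt : Real.log 3 < B := lt_of_not_ge hB3
    exact h₂ B hB2 (h₃ B hlt (h₁ hArch) hε)

/-- **The child BY ITS VERBATIM STATEMENT** (the route decl `SpectralTrace.CrystRegular` after the split
is this term; see `CrystRegular_of` below once the gate has written it). -/
theorem CrystRegular_of_stubs (h₁ : Registered.stub_firstOctave) (h₂ : Registered.stub_designReduction)
    (h₃ : Registered.stub_regularDesigns) :
    ∀ B : ℝ, Real.log 2 ≤ B →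
      Summit.RiemannHypothesis.RiemannHypothesis.Theses.SpectralTrace.WindowTraceArch →
        0 < Literature.NumberTheory.LFunctions.weilGroundEnergy (B / 2) →
          ∃ (ι : Type) (γ : ι → ℝ), ∀ g : ℝ → ℂ, Literature.NumberTheory.LFunctions.IsWeilTest g →
            tsupport g ⊆ Set.Icc (-B) B →
              HasSum (fun i => Literature.NumberTheory.LFunctions.weilMellin g (1 / 2 + (γ i : ℂ) * Complex.I))
                (Literature.NumberTheory.LFunctions.weilFunctional g) :=
  crystRegular_of h₁ h₂ h₃

/-! ### By-name conclusion (activate once the gate has written the child decl)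
After `route edit --split WindowStep --into children.json --glue-by …windowStep_of_dichotomy` the route
file carries `def CrystRegular : Prop := <the verbatim statement above>`; then this declaration (definitional
unfolding only) is appended and the file is registered with
`ledger skeleton check $(ledger crux dir <child-item>)/Lines/<slug>.lean --crux <child-item>`:

    theorem CrystRegular_of (h₁ : Registered.stub_firstOctave) (h₂ : Registered.stub_designReduction) (h₃ : Registered.stub_regularDesigns) :
        Summit.RiemannHypothesis.RiemannHypothesis.Theses.SpectralTrace.CrystRegular :=
      crystRegular_of h₁ h₂ h₃
-/

/-- **Where the child sits (informational, sorry-free):** with the sibling child `NoDegenerateEdge` of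
the split (verbatim), the child closes the PARENT crux `WindowStep` by the landed glue
`windowStep_of_dichotomy` (p140332). Not a stub of this line. -/
theorem windowStep_of_child_and_sibling (hR : CrystRegularStatement)
    (hE : ∀ a : ℝ, Real.log 3 / 2 ≤ a →
      (∀ B : ℝ, 0 < B → B < 2 * a →
        ∃ (ι : Type) (γ : ι → ℝ), ∀ g : ℝ → ℂ, Literature.NumberTheory.LFunctions.IsWeilTest g →
          tsupport g ⊆ Set.Icc (-B) B →
            HasSum (fun i => Literature.NumberTheory.LFunctions.weilMellin g (1 / 2 + (γ i : ℂ) * Complex.I))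
              (Literature.NumberTheory.LFunctions.weilFunctional g)) →
      0 < Literature.NumberTheory.LFunctions.weilGroundEnergy a) :
    Summit.RiemannHypothesis.RiemannHypothesis.Theses.SpectralTrace.WindowStep :=
  SpectralTraceWindowStep.windowStep_of_dichotomy hR hE


/-! ## Calibration (sorry-free): honesty of the stubs -/

/-- Stub 1 is implied outright by the sibling crux item (stmt-RiemannHypothesis-11196). -/
theorem firstOctave_of_windowTracePrime2 (h : WindowTracePrime2) : Registered.stub_firstOctave :=
  fun _ => h

/-- Stub 1 IS the child's first octave (landed `crystRegular_first_octave_iff`, restated over the local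
spelling). -/
theorem firstOctave_iff_child_first_octave :
    Registered.stub_firstOctave ↔
      (∀ B : ℝ, Real.log 2 ≤ B → B ≤ Real.log 3 → WindowTraceArch →
        0 < weilGroundEnergy (B / 2) → WTrace B) :=
  SpectralTraceWindowStep.crystRegular_first_octave_iff.symm

/-- The child gives stub 1 and the TRACE form of stub 3 (the regular ladder above `log 3`); with the
RH-free structure theorem of the seed line (every witness is a bounded displacement of the
França–LeClair lattice, landed stubs countingLaw/sortedEnumeration/displacementBound/structureAssembly)
the trace form gives the design form, so nothing registered is stronger than the child. Recorded here in
the trace form, which is pure logic. -/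
theorem regularLadder_of_child (h : CrystRegularStatement) :
    ∀ B : ℝ, Real.log 3 < B → WindowTracePrime2 → 0 < weilGroundEnergy (B / 2) → WTrace B := by
  intro B hB hP hε
  have h23 : Real.log 2 ≤ Real.log 3 := Real.log_le_log two_pos (by norm_num)
  exact h B (h23.trans hB.le) (windowTrace_anti h23 hP) hε

/-- Under RH every level is a rung, so the child (and the trace form of every stub) holds. -/
theorem child_of_riemannHypothesis (hRH : _root_.RiemannHypothesis) : CrystRegularStatement :=
  fun B _ _ _ => windowTrace_of_riemannHypothesis hRH B

end Summit.RiemannHypothesis.RiemannHypothesis.Cruxes.CrystRegular.FirstOctaveLadder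

end
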